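import Mathlib.LinearAlgebra.Eigenspace.Triangularizable
import Literature.NumberTheory.Automorphic.HeckeGelfandTrick
import HarnessLib

/-!
# `V^K` is a simple module over the Hecke operators; multiplicity one for commuting Hecke operators

Topic `NumberTheory/Automorphic`; generic complement to `HeckeAlgebra` (the concrete Hecke operators
`heckeOperator ρ K g = ∑_{yK ⊆ KgK} ρ(y)` on the `K`-fixed vectors `V^K = ρ.fixedPoints K` of a
representation `ρ` of a group `G`) and `HeckeGelfandTrick` (their commutativity from an
anti-involution). Everything here is PROVED; it is the algebraic half of **multiplicity one for
spherical vectors** (Cartier, *Representations of 𝔭-adic groups: a survey*, Corvallis 1979, §IV.1,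
Cor. 4.1 and §IV.4; Bump, *Automorphic Forms and Representations* (1997), Prop. 4.2.3 and
Thm. 4.6.2), used in `SatakeParametersGLProofs` to discharge
`Literature.NumberTheory.Automorphic.finrank_fixedPoints_glInt_le_one`.

## Main results (all proved, no topology, no Haar measure)

Let `K ≤ G` be a subgroup all of whose double cosets `KgK` are finite unions of left cosets
(`(MulAction.orbit K (g : G ⧸ K)).Finite` for all `g`, e.g. `K` compact open), `k` a field of
characteristic zero and `ρ` a representation of `G` on a `k`-space `V`.

* `eq_fixedPoints_of_heckeOperator_stable` (**Bump, Prop. 4.2.3, (ii) ⇒ (iii)**): if `ρ` is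
  irreducible (Mathlib `Representation.IsIrreducible`: no `G`-stable subspaces other than `⊥`, `⊤`),
  every non-zero subspace `W ≤ V^K` stable under all Hecke operators `[KgK]` is all of `V^K` — i.e.
  `V^K` is zero or a simple module over the Hecke operators.  Printed proof: for
  `v = ∑ π(φᵢ) wᵢ ∈ V^K` one has `v = ε_K v = ∑ π(ε_K * φᵢ * ε_K) wᵢ ∈ W`.  Here the projector `ε_K`
  is replaced by the finite coset sums `∑_{c ∈ K/B} ρ(c) u` over finite-index subgroups `B ≤ K`
  (`finsum_apply_out_mem_invariants`, `finsum_apply_out_eq_index_smul`,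
  `finsum_apply_out_eq_relIndex_smul`), and `ε_K π(g) ε_K ↦ [KgK] / deg` is
  `finsum_stabilizer_apply_eq_heckeOperator`: `∑_{c ∈ K/(K ∩ gKg⁻¹)} ρ(c g) w = [KgK] w` for
  `w ∈ V^K` (orbit–stabiliser for the `K`-orbit of `gK`).  No smoothness is needed: vectors in the
  `G`-span of `V^K` are fixed by finite-index subgroups of `K` by the Hecke-pair condition.
* `exists_heckeOperator_eq_smul`, `finrank_fixedPoints_le_one_of_heckeOperator_comm`
  (**Bump, Thm. 4.6.2; Cartier, Cor. 4.1**): if moreover `k` is algebraically closed, `V^K` is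
  finite-dimensional (admissibility) and the Hecke operators commute on `V^K` (Gelfand pair), then
  every `[KgK]` acts on `V^K` by a scalar and `dim V^K ≤ 1` (a common eigenspace, then a line, is a
  non-zero Hecke-stable subspace).

## References

* P. Cartier, *Representations of 𝔭-adic groups: a survey*, Proc. Sympos. Pure Math. 33 (1979),
  part 1, 111–155, §IV.1, Cor. 4.1 [CartierCorvallis1979].
* D. Bump, *Automorphic Forms and Representations*, Cambridge Stud. Adv. Math. 55 (1997),
  Prop. 4.2.3 (p. 427), Thm. 4.6.2 (p. 492) [Bump1997].
-/

noncomputable section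

open MulAction

namespace Literature.NumberTheory.Automorphic

/-! ### Coset sums over finite-index subgroups (the projector `ε_K` without Haar measure) -/

section CosetSum

variable {k H V : Type*} [CommRing k] [Group H] [AddCommGroup V] [Module k V]
  (σ : Representation k H V)

/-- For `u` fixed by the finite-index subgroup `B ≤ H`, the coset sum `∑_{c ∈ H/B} σ(c) u` (any
representatives) is `H`-invariant: `H` permutes `H ⧸ B` (the numerator of the averaging projector
`ε_H = [H:B]⁻¹ ∑_{H/B} σ(c)`; Bump (1997), §4.2, proof of Prop. 4.2.3). [folklore] -/
theorem finsum_apply_out_mem_invariants (B : Subgroup H) [B.FiniteIndex] {u : V}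
    (hu : u ∈ σ.fixedPoints B) : ∑ᶠ c : H ⧸ B, σ c.out u ∈ σ.invariants := by
  classical
  letI : Fintype (H ⧸ B) := Fintype.ofFinite _
  rw [finsum_eq_sum_of_fintype, Representation.mem_invariants]
  intro h
  rw [map_sum]
  simp_rw [← Module.End.mul_apply, ← map_mul, apply_mul_out_eq σ B hu]
  exact Fintype.sum_equiv (MulAction.toPerm h) _ _ fun _ => rfl

/-- On `H`-invariant vectors the coset sum over `H ⧸ B` is multiplication by the index `[H:B]`.
[folklore] -/
theorem finsum_apply_out_eq_index_smul (B : Subgroup H) [B.FiniteIndex] {u : V}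
    (hu : u ∈ σ.invariants) : ∑ᶠ c : H ⧸ B, σ c.out u = B.index • u := by
  classical
  letI : Fintype (H ⧸ B) := Fintype.ofFinite _
  rw [Representation.mem_invariants] at hu
  rw [finsum_eq_sum_of_fintype]
  simp_rw [hu]
  rw [Finset.sum_const, Finset.card_univ, Subgroup.index, Nat.card_eq_fintype_card]

/-- **Independence of the subgroup.** For finite-index subgroups `A ≤ B ≤ H` and `u` fixed by `B`,
`∑_{c ∈ H/A} σ(c) u = [B:A] • ∑_{d ∈ H/B} σ(d) u`: group the cosets of `A` along
`H ⧸ A ≃ (H ⧸ B) × (B ⧸ A)` (`Subgroup.quotientEquivProdOfLE`). This is the statement that the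
averaging projector `[H:B]⁻¹ ∑_{H/B} σ(c)` does not depend on `B`. [folklore] -/
theorem finsum_apply_out_eq_relIndex_smul {A B : Subgroup H} (hAB : A ≤ B) [A.FiniteIndex]
    {u : V} (hu : u ∈ σ.fixedPoints B) :
    ∑ᶠ c : H ⧸ A, σ c.out u = A.relIndex B • ∑ᶠ d : H ⧸ B, σ d.out u := by
  classical
  haveI : B.FiniteIndex := Subgroup.finiteIndex_of_le hAB
  letI : Fintype (H ⧸ A) := Fintype.ofFinite _
  letI : Fintype (H ⧸ B) := Fintype.ofFinite _
  letI : Fintype (B ⧸ A.subgroupOf B) := Fintype.ofFinite _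
  set e := Subgroup.quotientEquivProdOfLE hAB with he
  have key : ∀ c : H ⧸ A, σ c.out u = σ (e c).1.out u := by
    intro c
    refine apply_eq_of_mk_eq σ B hu ?_
    rw [QuotientGroup.out_eq', he, Subgroup.quotientEquivProdOfLE_apply]
    conv_rhs => rw [← QuotientGroup.out_eq' c]
    rfl
  rw [finsum_eq_sum_of_fintype, finsum_eq_sum_of_fintype]
  calc ∑ c : H ⧸ A, σ c.out u
      = ∑ c : H ⧸ A, (fun p : (H ⧸ B) × B ⧸ A.subgroupOf B => σ p.1.out u) (e c) :=
        Finset.sum_congr rfl fun c _ => key c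
    _ = ∑ p : (H ⧸ B) × B ⧸ A.subgroupOf B, σ p.1.out u := Fintype.sum_equiv e _ _ fun _ => rfl
    _ = ∑ d : H ⧸ B, ∑ _c : B ⧸ A.subgroupOf B, σ d.out u := Fintype.sum_prod_type _
    _ = ∑ d : H ⧸ B, A.relIndex B • σ d.out u := by
        refine Finset.sum_congr rfl fun d _ => ?_
        rw [Finset.sum_const, Finset.card_univ, Subgroup.relIndex, Subgroup.index,
          Nat.card_eq_fintype_card]
    _ = A.relIndex B • ∑ d : H ⧸ B, σ d.out u := Finset.smul_sum.symm

end CosetSum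

/-! ### The coset sum over `K ⧸ (K ∩ gKg⁻¹)` of `ρ(g) w` is the Hecke operator `[KgK] w` -/

section Stabilizer

variable {k G V : Type*} [CommRing k] [Group G] [AddCommGroup V] [Module k V]
  (ρ : Representation k G V) (K : Subgroup G)

/-- The stabiliser `K ∩ gKg⁻¹` of the coset `gK` in `K` has finite index when the double coset
`KgK` is a finite union of left cosets (orbit–stabiliser). [folklore] -/
theorem finiteIndex_stabilizer (g : G) (hfin : (orbit K (g : G ⧸ K)).Finite) :
    (stabilizer K (g : G ⧸ K)).FiniteIndex := by
  haveI : Finite (orbit K (g : G ⧸ K)) := hfin.to_subtype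
  haveI : Finite (K ⧸ stabilizer K (g : G ⧸ K)) :=
    Finite.of_equiv _ (orbitEquivQuotientStabilizer K (g : G ⧸ K))
  exact Subgroup.finiteIndex_of_finite_quotient

/-- For `w ∈ V^K`, the vector `ρ(g) w` is fixed by the stabiliser `K ∩ gKg⁻¹` of `gK` in `K`
(as a subgroup of `K`, acting through the restriction `ρ|_K`). [folklore] -/
theorem apply_mem_fixedPoints_stabilizer (g : G) {w : V} (hw : w ∈ ρ.fixedPoints K) :
    ρ g w ∈ Representation.fixedPoints (ρ.comp K.subtype) (stabilizer K (g : G ⧸ K)) := by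
  rw [Representation.mem_fixedPoints]
  intro s hs
  change ρ (s : G) (ρ g w) = ρ g w
  rw [← Module.End.mul_apply, ← map_mul]
  exact apply_eq_of_mk_eq ρ K hw (mem_stabilizer_iff.1 hs)

/-- **`ε_K π(g) ε_K = [KgK] / deg`.** For `w ∈ V^K` and a finite double coset `KgK`, the coset sum
of `ρ(g) w` over `K ⧸ (K ∩ gKg⁻¹)` is the Hecke operator: `∑_{c ∈ K/(K ∩ gKg⁻¹)} ρ(c g) w = [KgK] w`,
by the orbit–stabiliser bijection `K/(K ∩ gKg⁻¹) ≃ KgK/K`, `c ↦ cgK` (Bump (1997), proof of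
Prop. 4.2.3; Shimura (1971), Prop. 3.1). [folklore] -/
theorem finsum_stabilizer_apply_eq_heckeOperator (g : G) (hfin : (orbit K (g : G ⧸ K)).Finite)
    {w : V} (hw : w ∈ ρ.fixedPoints K) :
    ∑ᶠ c : K ⧸ stabilizer K (g : G ⧸ K), (ρ.comp K.subtype) c.out (ρ g w) =
      heckeOperator ρ K g w := by
  classical
  haveI : Fintype (orbit K (g : G ⧸ K)) := hfin.fintype
  set e := orbitEquivQuotientStabilizer K (g : G ⧸ K) with he
  letI : Fintype (K ⧸ stabilizer K (g : G ⧸ K)) := Fintype.ofEquiv _ e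
  rw [finsum_eq_sum_of_fintype, heckeOperator_apply_eq_sum_out ρ K g hfin hw,
    Finset.sum_subtype hfin.toFinset (fun α => hfin.mem_toFinset) (fun α : G ⧸ K => ρ α.out w)]
  refine Fintype.sum_equiv e.symm _ _ fun c => ?_
  have hc : ((e.symm c : orbit K (g : G ⧸ K)) : G ⧸ K) = (((c.out : K) : G) * g : G) := by
    conv_lhs => rw [← QuotientGroup.out_eq' c]
    rfl
  rw [apply_eq_of_mk_eq ρ K hw ((QuotientGroup.out_eq' _).trans hc), map_mul, Module.End.mul_apply]
  rfl

end Stabilizer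

/-! ### `V^K` is a simple module over the Hecke operators (Bump, Prop. 4.2.3) -/

section Simple

variable {k G V : Type*} [Field k] [CharZero k] [Group G] [AddCommGroup V] [Module k V]
  (ρ : Representation k G V) (K : Subgroup G)

/-- **`V^K` is a simple module over the Hecke operators** (Bump, *Automorphic Forms and
Representations* (1997), Prop. 4.2.3, (ii) ⇒ (iii); Cartier, Corvallis 1979, §IV.1). Let every
double coset `KgK` be a finite union of left cosets and let `ρ` be an irreducible representation
of `G` over a field of characteristic zero. If `W ≤ V^K` is a non-zero subspace stable under every
Hecke operator `[KgK]`, then `W = V^K`. Proof: the `k`-span of `ρ(G) W` is a non-zero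
subrepresentation, hence all of `V`; every vector `u` in it is fixed by a finite-index subgroup
`B ≤ K` with all coset sums `∑_{K/A} ρ(c) u ∈ W` (`A ≤ B` of finite index) — for `u = ρ(g) w` this
is `[K ∩ gKg⁻¹ : A] • [KgK] w ∈ W` — and for `u = v ∈ V^K` the coset sum is `[K:B] • v`, so `v ∈ W`.
[cite: Bump1997, Prop. 4.2.3] -/
theorem eq_fixedPoints_of_heckeOperator_stable [ρ.IsIrreducible]
    (hfin : ∀ g : G, (orbit K (g : G ⧸ K)).Finite) {W : Submodule k V}
    (hWK : W ≤ ρ.fixedPoints K) (hW : W ≠ ⊥)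
    (hstab : ∀ g : G, ∀ w ∈ W, heckeOperator ρ K g w ∈ W) : W = ρ.fixedPoints K := by
  classical
  refine le_antisymm hWK fun v hv => ?_
  -- the `G`-translates of `W` and their span, a subrepresentation
  set S : Set V := ⋃ g : G, ρ g '' (W : Set V) with hS
  have hSsub : ∀ g : G, ρ g '' S ⊆ S := by
    rintro g _ ⟨x, hx, rfl⟩
    obtain ⟨h, hxh⟩ := Set.mem_iUnion.1 hx
    obtain ⟨w, hw, rfl⟩ := hxh
    refine Set.mem_iUnion.2 ⟨g * h, w, hw, ?_⟩
    rw [map_mul, Module.End.mul_apply]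
  obtain ⟨U, hU⟩ : ∃ U : Subrepresentation ρ, U.toSubmodule = Submodule.span k S :=
    ⟨⟨Submodule.span k S, fun g x hx => by
        have h := Submodule.mem_map_of_mem (f := ρ g) hx
        rw [Submodule.map_span] at h
        exact Submodule.span_mono (hSsub g) h⟩, rfl⟩
  obtain ⟨w₀, hw₀, hw₀0⟩ := (Submodule.ne_bot_iff W).1 hW
  have hw₀S : w₀ ∈ S := Set.mem_iUnion.2 ⟨1, w₀, hw₀, by rw [map_one, Module.End.one_apply]⟩
  have hUbot : U ≠ ⊥ := by
    intro h
    have hmem : w₀ ∈ U.toSubmodule := hU ▸ Submodule.subset_span hw₀S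
    rw [h] at hmem
    exact hw₀0 ((Submodule.mem_bot k).1 hmem)
  have hUtop : U = ⊤ := (IsSimpleOrder.eq_bot_or_eq_top U).resolve_left hUbot
  have hvU : v ∈ Submodule.span k S := by
    rw [← hU, hUtop]
    exact Submodule.mem_top
  -- every vector of the span is fixed by a finite-index `B ≤ K`, with all coset sums in `W`
  have key : ∀ u ∈ Submodule.span k S, ∃ B : Subgroup K, B.FiniteIndex ∧
      u ∈ Representation.fixedPoints (ρ.comp K.subtype) B ∧ ∀ A : Subgroup K, A ≤ B → A.FiniteIndex →
        ∑ᶠ c : K ⧸ A, (ρ.comp K.subtype) c.out u ∈ W := by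
    intro u hu
    induction hu using Submodule.span_induction with
    | mem x hx =>
      obtain ⟨g, hxg⟩ := Set.mem_iUnion.1 hx
      obtain ⟨w, hw, rfl⟩ := hxg
      refine ⟨stabilizer K (g : G ⧸ K), finiteIndex_stabilizer K g (hfin g),
        apply_mem_fixedPoints_stabilizer ρ K g (hWK hw), fun A hA _ => ?_⟩
      rw [finsum_apply_out_eq_relIndex_smul (ρ.comp K.subtype) hA
          (apply_mem_fixedPoints_stabilizer ρ K g (hWK hw)),
        finsum_stabilizer_apply_eq_heckeOperator ρ K g (hfin g) (hWK hw)]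
      exact nsmul_mem (hstab g w hw) _
    | zero =>
      refine ⟨⊤, inferInstance, Submodule.zero_mem _, fun A _ _ => ?_⟩
      simp only [map_zero, finsum_zero]
      exact W.zero_mem
    | add x y _ _ ihx ihy =>
      obtain ⟨B₁, hB₁, hx₁, h₁⟩ := ihx
      obtain ⟨B₂, hB₂, hy₂, h₂⟩ := ihy
      refine ⟨B₁ ⊓ B₂, ⟨Subgroup.index_inf_ne_zero hB₁.index_ne_zero hB₂.index_ne_zero⟩,
        Submodule.add_mem _ (Representation.fixedPoints_antitone (ρ.comp K.subtype) inf_le_left hx₁)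
          (Representation.fixedPoints_antitone (ρ.comp K.subtype) inf_le_right hy₂), fun A hA hAfi => ?_⟩
      letI : Fintype (K ⧸ A) := Fintype.ofFinite _
      simp only [map_add, finsum_eq_sum_of_fintype, Finset.sum_add_distrib]
      have hx' := h₁ A (hA.trans inf_le_left) hAfi
      have hy' := h₂ A (hA.trans inf_le_right) hAfi
      rw [finsum_eq_sum_of_fintype] at hx' hy'
      exact W.add_mem hx' hy'
    | smul a x _ ih =>
      obtain ⟨B, hB, hxB, h⟩ := ih
      refine ⟨B, hB, Submodule.smul_mem _ a hxB, fun A hA hAfi => ?_⟩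
      letI : Fintype (K ⧸ A) := Fintype.ofFinite _
      simp only [map_smul, finsum_eq_sum_of_fintype, ← Finset.smul_sum]
      have hx' := h A hA hAfi
      rw [finsum_eq_sum_of_fintype] at hx'
      exact W.smul_mem a hx'
  obtain ⟨B, hBfi, -, hB⟩ := key v hvU
  have hvinv : v ∈ Representation.invariants (ρ.comp K.subtype) := hv
  have hmem := hB B le_rfl hBfi
  rw [finsum_apply_out_eq_index_smul (ρ.comp K.subtype) B hvinv, ← Nat.cast_smul_eq_nsmul k] at hmem
  have hidx : (B.index : k) ≠ 0 := Nat.cast_ne_zero.2 hBfi.index_ne_zero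
  rw [show v = (B.index : k)⁻¹ • ((B.index : k) • v) by
    rw [smul_smul, inv_mul_cancel₀ hidx, one_smul]]
  exact W.smul_mem _ hmem

end Simple

/-! ### Multiplicity one for commuting Hecke operators (Bump, Thm. 4.6.2; Cartier, Cor. 4.1) -/

section MultiplicityOne

variable {k G V : Type*} [Field k] [CharZero k] [IsAlgClosed k] [Group G] [AddCommGroup V]
  [Module k V] (ρ : Representation k G V) (K : Subgroup G)

/-- **Hecke operators act by scalars on `V^K`.** For an irreducible representation over an
algebraically closed field of characteristic zero with `V^K` finite-dimensional, finite double
cosets `KgK` and pairwise commuting Hecke operators on `V^K`, every `[KgK]` acts on `V^K` by a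
scalar: an eigenspace of `[KgK]` in `V^K` is a non-zero Hecke-stable subspace, hence all of `V^K`
(`eq_fixedPoints_of_heckeOperator_stable`) (Bump (1997), Thm. 4.6.2 and (6.1); Cartier, Corvallis
1979, §IV.1, Cor. 4.1). [cite: Bump1997, Thm. 4.6.2] -/
theorem exists_heckeOperator_eq_smul [ρ.IsIrreducible] [Module.Finite k (ρ.fixedPoints K)]
    (hfin : ∀ g : G, (orbit K (g : G ⧸ K)).Finite)
    (hcomm : ∀ x y : G, ∀ v ∈ ρ.fixedPoints K,
      heckeOperator ρ K x (heckeOperator ρ K y v) = heckeOperator ρ K y (heckeOperator ρ K x v))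
    (g : G) : ∃ μ : k, ∀ v ∈ ρ.fixedPoints K, heckeOperator ρ K g v = μ • v := by
  classical
  by_cases h0 : ρ.fixedPoints K = ⊥
  · refine ⟨0, fun v hv => ?_⟩
    rw [h0, Submodule.mem_bot] at hv
    rw [hv, map_zero, smul_zero]
  haveI : Nontrivial (ρ.fixedPoints K) := Submodule.nontrivial_iff_ne_bot.2 h0
  let T : Module.End k (ρ.fixedPoints K) :=
    (heckeOperator ρ K g).restrict fun v hv => heckeOperator_apply_mem_fixedPoints ρ K g hv (hfin g)
  have hT : ∀ v : ρ.fixedPoints K, (T v : V) = heckeOperator ρ K g v := fun v => rfl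
  obtain ⟨μ, hμ⟩ := Module.End.exists_eigenvalue T
  refine ⟨μ, ?_⟩
  -- the `μ`-eigenspace of `[KgK]` inside `V^K`, as a subspace of `V`
  set W : Submodule k V :=
    ρ.fixedPoints K ⊓ LinearMap.ker (heckeOperator ρ K g - μ • LinearMap.id) with hW
  have hmemW : ∀ {v : V}, v ∈ W ↔ v ∈ ρ.fixedPoints K ∧ heckeOperator ρ K g v = μ • v := by
    intro v
    rw [hW, Submodule.mem_inf, LinearMap.mem_ker, LinearMap.sub_apply, LinearMap.smul_apply,
      LinearMap.id_apply, sub_eq_zero]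
  have hWK : W ≤ ρ.fixedPoints K := fun v hv => (hmemW.1 hv).1
  have hW0 : W ≠ ⊥ := by
    obtain ⟨x, hx⟩ := hμ.exists_hasEigenvector
    refine (Submodule.ne_bot_iff W).2 ⟨x, hmemW.2 ⟨x.2, ?_⟩, fun h => hx.2 (Subtype.ext h)⟩
    rw [← hT, hx.apply_eq_smul, Submodule.coe_smul]
  have hstab : ∀ h : G, ∀ w ∈ W, heckeOperator ρ K h w ∈ W := by
    intro h w hw
    obtain ⟨hwK, hw'⟩ := hmemW.1 hw
    refine hmemW.2 ⟨heckeOperator_apply_mem_fixedPoints ρ K h hwK (hfin h), ?_⟩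
    rw [hcomm g h w hwK, hw', map_smul]
  have hWeq := eq_fixedPoints_of_heckeOperator_stable ρ K hfin hWK hW0 hstab
  intro v hv
  rw [← hWeq] at hv
  exact (hmemW.1 hv).2

/-- **Multiplicity one** (Bump, *Automorphic Forms and Representations* (1997), Thm. 4.6.2;
Cartier, Corvallis 1979, §IV.1, Cor. 4.1 and §IV.4): for an irreducible representation `ρ` of `G`
over an algebraically closed field of characteristic zero such that `V^K` is finite-dimensional,
the double cosets `KgK` are finite unions of left cosets and the Hecke operators commute on `V^K`
(a Gelfand pair), `dim V^K ≤ 1`: by `exists_heckeOperator_eq_smul` every Hecke operator is a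
scalar on `V^K`, so any line in `V^K` is Hecke-stable and equals `V^K`
(`eq_fixedPoints_of_heckeOperator_stable`). [cite: Bump1997, Thm. 4.6.2] -/
theorem finrank_fixedPoints_le_one_of_heckeOperator_comm [ρ.IsIrreducible]
    [Module.Finite k (ρ.fixedPoints K)] (hfin : ∀ g : G, (orbit K (g : G ⧸ K)).Finite)
    (hcomm : ∀ x y : G, ∀ v ∈ ρ.fixedPoints K,
      heckeOperator ρ K x (heckeOperator ρ K y v) = heckeOperator ρ K y (heckeOperator ρ K x v)) :
    Module.finrank k (ρ.fixedPoints K) ≤ 1 := by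
  by_cases h0 : ρ.fixedPoints K = ⊥
  · rw [h0, finrank_bot]
    exact zero_le_one
  obtain ⟨v₀, hv₀, hv₀0⟩ := (Submodule.ne_bot_iff _).1 h0
  have hLK : (k ∙ v₀) ≤ ρ.fixedPoints K := (Submodule.span_singleton_le_iff_mem v₀ _).2 hv₀
  have hL0 : (k ∙ v₀) ≠ ⊥ := by
    rw [Ne, Submodule.span_singleton_eq_bot]
    exact hv₀0
  have hstab : ∀ g : G, ∀ w ∈ k ∙ v₀, heckeOperator ρ K g w ∈ k ∙ v₀ := by
    intro g w hw
    obtain ⟨μ, hμ⟩ := exists_heckeOperator_eq_smul ρ K hfin hcomm g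
    rw [hμ w (hLK hw)]
    exact Submodule.smul_mem _ μ hw
  have h := eq_fixedPoints_of_heckeOperator_stable ρ K hfin hLK hL0 hstab
  rw [← h]
  exact (finrank_span_singleton hv₀0).le

end MultiplicityOne

end Literature.NumberTheory.Automorphic
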